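import Literature.MathematicalPhysics.StatisticalMechanics.NJLChiralSymmetryBreaking
import Literature.MathematicalPhysics.StatisticalMechanics.NJLExponentialClustering
import Literature.MathematicalPhysics.StatisticalMechanics.ComplexSpinCorrelationBound
import HarnessLib

/-!
# The weak Goldstone theorem of Salmhofer–Seiler: clustering cannot be uniform as the mass vanishes
# (CMP 139 (1991), Remark 3.12 with the Ward identity (3.43) and Cor. 4.4 (1))

Salmhofer–Seiler, p. 409, after Thm. 3.11: "The Ward identities which one can derive by doing
space-dependent chiral rotations relate the expectation value of `ψ̄ψ` directly to its two-point
function for staggered fermions, `⟨ψ̄ψ(y)⟩ = -m ∑_x ε(x)ε(y) ⟨ψ̄ψ(x) ψ̄ψ(y)⟩^T` (3.43) (the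
truncation can be included because of the alternating signs `ε(x)` in the sum). Inserting the
exponential decay with rate `κ(m)` into this equation one sees that if chiral symmetry is broken in
the sense of `X ≠ 0`, the mass gap `κ(m)` must go to zero as the mass vanishes. One may regard this
as a weak version of the Goldstone theorem." (Remark 3.12.)

This file proves the remark for the β = 0 NJL system on the even tori `(ℤ/Lℤ)^ν` in the form
that the restated Thm. 3.11 of the Erratum (CMP 146 (1992) 637: `m`-dependent prefactor for
complex masses) supports WITHOUT the Erratum's sharper real-mass form (5): with the clustering
hypothesis written exactly as the conclusion of the tree's Thm. 3.11
(`NJLExponentialClustering.njl_abs_truncatedTwoPoint_le_real`: `|⟨σ_xσ_y⟩_Λ - ⟨σ_x⟩_Λ⟨σ_y⟩_Λ| ≤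
C e^{-κD}` for `D ≤ |x_i - y_i|`, `|x_i - y_i| + D ≤ L`),

* `njl_expect_X_le_sum_abs_truncated` — the Ward identity (3.43) of the tree
  (`NJLChiralCondensateLowerBound.ward_identity`) with the truncation inserted (`∑_x ε(x) = 0`,
  translation invariance): `⟨σ_0⟩_Λ ≤ 2Nm ∑_x |⟨σ_xσ_0⟩_Λ - ⟨σ_x⟩_Λ⟨σ_0⟩_Λ|` at real `m > 0`;
* `njl_expect_X_le_of_clustering` — "inserting the exponential decay": clustering with constants
  `(κ, C)` on a torus gives `⟨σ_0⟩_Λ(m) ≤ 2Nm(2 + C (∑_{j∈ℤ} e^{-κ|j|/ν})^ν)`, the lattice sum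
  bounded uniformly in `L` through centred representatives (`ZMod.valMinAbs`) and
  `∑_{z ∈ Λ} ∏_i e^{-(κ/ν)|z̃_i|} = (∑_t e^{-(κ/ν)|t̃|})^ν`;
* `njl_condensate_le_of_uniformClustering` — hence, if `(κ, C)` serve for all `m ∈ (0, m₀]` and all
  even tori, the condensate `s(m) = lim_Λ ⟨σ_0⟩_Λ(m)` of Thm. 4.3 is `O(m)` on `(0, m₀]`;
* `njl_clustering_not_uniform_as_mass_vanishes` — so under `2S(ν)/N < 1`, where Cor. 4.4 (1) gives
  `X = liminf_{m→0+} s(m) > 0` (tree: `njl_chiralOrderParameter_bounds`), NO pair `(κ > 0, C)`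
  serves on any `(0, m₀]`: along `m → 0+` the optimal clustering constants degenerate, `κ(m) → 0`
  or `C(m) → ∞`; primed version hypothesis-free for QED (`N = 1`, `ν ≥ 4`) and NJL `N ≥ 2`,
  `ν ≥ 3` (`two_mul_fluctS_div_lt_one`);
* `njl_clustering_constants_at_fixed_mass` — whereas at each fixed real `m ≠ 0` such constants DO
  exist (Thm. 3.11, `NJLExponentialClustering`).

Faithfulness / scope.  The printed conclusion "`κ(m) → 0`" uses the Erratum's (5) (prefactor `1`
for real `m`, from the transfer operator), which is not formalised; what is proved is the
disjunction forced by (3.43) and `X > 0` on the pair (rate, prefactor).  Cor. 4.4 (4)'s rate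
`κ(m) ≤ const·m^{1/ν}` (4.19) is likewise not formalised.  β = 0 NJL ∕ strongly coupled QED on
tori only; nothing about β > 0, the continuum, `SU(N)`, a mass gap of the gauge theory or the
summit's `QCD` conjunct.

## References

* M. Salmhofer, E. Seiler, *Proof of chiral symmetry breaking in strongly coupled lattice gauge
  theory*, Commun. Math. Phys. 139 (1991) 395–432: Remark 3.12 and (3.43) p. 409, Cor. 4.4 (1),
  (4) pp. 419–420. [SalmhoferSeiler1991]
* M. Salmhofer, E. Seiler, Erratum, Commun. Math. Phys. 146 (1992) 637–638: (1), (5).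
  [SalmhoferSeiler1992Erratum]
-/

noncomputable section

open Filter Topology MvPolynomial Finset

namespace Literature.MathematicalPhysics.StatisticalMechanics

namespace ComplexSpin

open Literature.Probability.LatticeModels (TorusSite Site)
open Literature.Probability.LatticeModels

variable {ν : ℕ}

/-! ### Summing an exponential over the torus, uniformly in its size -/

/-- The two-sided geometric series `∑_{j ∈ ℤ} e^{-a|j|}` converges for `a > 0`. [folklore] -/
private theorem summable_exp_neg_mul_abs_int {a : ℝ} (ha : 0 < a) :
    Summable fun j : ℤ => Real.exp (-a * |(j : ℝ)|) := by
  have hgeo : Summable fun n : ℕ => Real.exp (-a) ^ n :=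
    summable_geometric_of_lt_one (Real.exp_pos _).le (Real.exp_lt_one_iff.2 (by linarith))
  have h1 : Summable fun n : ℕ => Real.exp (-a * |((n : ℤ) : ℝ)|) := by
    refine hgeo.congr fun n => ?_
    rw [Int.cast_natCast, abs_of_nonneg (Nat.cast_nonneg n), ← Real.exp_nat_mul]; ring_nf
  have h2 : Summable fun n : ℕ => Real.exp (-a * |((-(n : ℤ) : ℤ) : ℝ)|) := by
    refine hgeo.congr fun n => ?_
    rw [Int.cast_neg, Int.cast_natCast, abs_neg, abs_of_nonneg (Nat.cast_nonneg n),
      ← Real.exp_nat_mul]; ring_nf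
  exact Summable.of_nat_of_neg h1 h2

/-- On `ℤ/Lℤ`: `∑_t e^{-a|t̃|} ≤ ∑_{j ∈ ℤ} e^{-a|j|}`, `t̃ ∈ (-L/2, L/2]` the centred
representative. [folklore] -/
private theorem sum_exp_neg_valMinAbs_le {a : ℝ} (ha : 0 < a) (L : ℕ) [NeZero L] :
    ∑ t : ZMod L, Real.exp (-a * |((ZMod.valMinAbs t : ℤ) : ℝ)|) ≤
      ∑' j : ℤ, Real.exp (-a * |(j : ℝ)|) := by
  classical
  have hinj : Set.InjOn (ZMod.valMinAbs : ZMod L → ℤ) (Finset.univ : Finset (ZMod L)) :=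
    fun a _ b _ h => ZMod.injective_valMinAbs h
  rw [← Finset.sum_image (f := fun j : ℤ => Real.exp (-a * |(j : ℝ)|)) hinj]
  exact (summable_exp_neg_mul_abs_int ha).sum_le_tsum _ fun _ _ => (Real.exp_pos _).le

/-- **Uniform summability on the torus**: for `κ > 0`,
`∑_{z ∈ (ℤ/Lℤ)^ν} ∏_i e^{-(κ/ν)|z̃_i|} ≤ (∑_{j∈ℤ} e^{-(κ/ν)|j|})^ν` for every `L`. [folklore] -/
private theorem sum_prod_exp_neg_le {κ : ℝ} (hκ : 0 < κ) (hν : 1 ≤ ν) (L : ℕ) [NeZero L] :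
    ∑ z : TorusSite ν L, ∏ i : Fin ν, Real.exp (-(κ / ν) * |((ZMod.valMinAbs (z i) : ℤ) : ℝ)|) ≤
      (∑' j : ℤ, Real.exp (-(κ / ν) * |(j : ℝ)|)) ^ ν := by
  have hνpos : (0 : ℝ) < ν := by exact_mod_cast Nat.lt_of_lt_of_le Nat.zero_lt_one hν
  have ha : 0 < κ / ν := div_pos hκ hνpos
  have heq : ∑ z : TorusSite ν L, ∏ i : Fin ν, Real.exp (-(κ / ν) * |((ZMod.valMinAbs (z i) : ℤ) : ℝ)|) =
      (∑ t : ZMod L, Real.exp (-(κ / ν) * |((ZMod.valMinAbs t : ℤ) : ℝ)|)) ^ ν := by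
    rw [Fintype.sum_pow]
  rw [heq]
  exact pow_le_pow_left₀ (Finset.sum_nonneg fun _ _ => (Real.exp_pos _).le)
    (sum_exp_neg_valMinAbs_le ha L) ν


/-! ### Centred representatives: every torus point is separated from `0` as the clustering
hypotheses require -/

/-- For `z ≠ 0` on `(ℤ/Lℤ)^ν`: the centred representative `x` (`x_i ∈ (-L/2, L/2]`, `x̄ = z`),
the direction `i` of its largest coordinate and `D = |x_i| ≥ 1` satisfy `D ≤ |x_i - 0|`,
`|x_i - 0| + D ≤ L`, and `e^{-κD} ≤ ∏_j e^{-(κ/ν)|x_j|}`. [folklore] -/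
private theorem exists_rep_of_ne_zero (hν : 1 ≤ ν) {L : ℕ} [NeZero L] {κ : ℝ} (hκ : 0 ≤ κ)
    {z : TorusSite ν L} (hz : z ≠ 0) :
    ∃ (x : Site ν) (i : Fin ν) (D : ℕ), Torus.proj L x = z ∧ 1 ≤ D ∧
      (D : ℤ) ≤ |x i - (0 : Site ν) i| ∧ |x i - (0 : Site ν) i| + (D : ℤ) ≤ L ∧
      Real.exp (-κ * D) ≤ ∏ j : Fin ν, Real.exp (-(κ / ν) * |((ZMod.valMinAbs (z j) : ℤ) : ℝ)|) := by
  haveI : Nonempty (Fin ν) := ⟨⟨0, by omega⟩⟩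
  have hνpos : (0 : ℝ) < ν := by exact_mod_cast Nat.lt_of_lt_of_le Nat.zero_lt_one hν
  set x : Site ν := fun j => ZMod.valMinAbs (z j) with hx
  obtain ⟨i, -, hi⟩ := Finset.exists_max_image Finset.univ (fun j => (x j).natAbs) Finset.univ_nonempty
  refine ⟨x, i, (x i).natAbs, ?_, ?_, ?_, ?_, ?_⟩
  · funext j
    simp [Torus.proj, hx, ZMod.coe_valMinAbs]
  · obtain ⟨j, hj⟩ : ∃ j, z j ≠ 0 := by
      by_contra h
      push Not at h
      exact hz (funext h)
    have h1 : (x j).natAbs ≠ 0 := by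
      rw [ne_eq, Int.natAbs_eq_zero, hx]
      exact fun h0 => hj ((ZMod.valMinAbs_eq_zero _).1 h0)
    have h2 := hi j (Finset.mem_univ j)
    omega
  · rw [Pi.zero_apply, sub_zero, ← Int.natCast_natAbs]
  · have h1 : (x i).natAbs ≤ L / 2 := ZMod.natAbs_valMinAbs_le (z i)
    have h2 : 2 * (L / 2) ≤ L := Nat.mul_div_le L 2
    have h3 : (x i).natAbs + (x i).natAbs ≤ L := by omega
    rw [Pi.zero_apply, sub_zero, ← Int.natCast_natAbs]
    exact_mod_cast h3
  · rw [← Real.exp_sum, Real.exp_le_exp, ← Finset.mul_sum]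
    have hsum : ∑ j : Fin ν, |((ZMod.valMinAbs (z j) : ℤ) : ℝ)| ≤ ν * ((x i).natAbs : ℝ) := by
      calc ∑ j : Fin ν, |((ZMod.valMinAbs (z j) : ℤ) : ℝ)| ≤ ∑ _j : Fin ν, ((x i).natAbs : ℝ) := by
            refine Finset.sum_le_sum fun j _ => ?_
            have h1 : (x j).natAbs ≤ (x i).natAbs := hi j (Finset.mem_univ j)
            have h2 : |((ZMod.valMinAbs (z j) : ℤ) : ℝ)| = ((x j).natAbs : ℝ) := by
              rw [← Int.cast_abs, ← Int.natCast_natAbs, Int.cast_natCast]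
            rw [h2]; exact_mod_cast h1
        _ = ν * ((x i).natAbs : ℝ) := by rw [Finset.sum_const, Finset.card_univ, Fintype.card_fin]; ring
    have : κ / ν * ∑ j : Fin ν, |((ZMod.valMinAbs (z j) : ℤ) : ℝ)| ≤ κ * (x i).natAbs := by
      calc κ / ν * ∑ j : Fin ν, |((ZMod.valMinAbs (z j) : ℤ) : ℝ)| ≤ κ / ν * (ν * ((x i).natAbs : ℝ)) :=
            mul_le_mul_of_nonneg_left hsum (div_nonneg hκ hνpos.le)
        _ = κ * (x i).natAbs := by field_simp
    linarith

/-- The staggered sign has modulus one. [folklore] -/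
private theorem abs_sgn_cast {L : ℕ} [NeZero L] (hL : 2 ∣ L) (x : TorusSite ν L) :
    |((sgn hL x : ℤ) : ℝ)| = 1 := by
  unfold sgn; split_ifs <;> simp

/-! ### Remark 3.12: the Ward identity turns clustering into an upper bound on the condensate -/

/-- **The condensate is at most `2Nm ∑_x |⟨σ_x;σ_0⟩_Λ|`** (Ward identity (3.43) with the
truncation inserted — "the truncation can be included because of the alternating signs `ε(x)` in
the sum"): for the NJL system at real `m > 0` on an even torus,
`⟨σ_0⟩_Λ ≤ 2Nm ∑_{x ∈ Λ} |⟨σ_xσ_0⟩_Λ - ⟨σ_x⟩_Λ⟨σ_0⟩_Λ|`. [cite: SalmhoferSeiler1991, (3.43) and Remark 3.12] -/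
theorem njl_expect_X_le_sum_abs_truncated (hν : 1 ≤ ν) {N : ℕ} (hN : 1 ≤ N) {L : ℕ} [NeZero L]
    (hL : Even L) {m : ℝ} (hm : 0 < m) :
    expect (ν := ν) (L := L) N m (njlBondCoeff N) (X 0) ≤
      2 * N * m * ∑ x : TorusSite ν L,
        |expect N m (njlBondCoeff N) (X x * X 0) -
          expect N m (njlBondCoeff N) (X x) * expect (ν := ν) (L := L) N m (njlBondCoeff N) (X 0)| := by
  have hL2 : 2 ∣ L := even_iff_two_dvd.1 hL
  have hL2' : 2 ≤ L := by
    obtain ⟨k, hk⟩ := hL; have := NeZero.ne L; omega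
  set a := njlBondCoeff N with ha
  have hZ : 0 < partitionFunction (ν := ν) (L := L) N m a := njl_partitionFunction_pos hν hL hN hm.le
  have hward := ward_identity hL2 hL2' hν (hasLog_njl N) m (0 : TorusSite ν L)
  -- divide the Ward identity by `Z`
  have hexp : expect (ν := ν) (L := L) N m a (X 0) =
      -(2 * N * m) * ∑ x : TorusSite ν L,
        (sgn hL2 x : ℝ) * (sgn hL2 (0 : TorusSite ν L) : ℝ) * expect N m a (X x * X 0) := by
    unfold expect
    rw [hward, mul_div_assoc, Finset.sum_div]
    congr 1
    refine Finset.sum_congr rfl fun x _ => ?_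
    rw [mul_div_assoc]
  -- insert the truncation: `∑_x ε(x) ⟨σ_x⟩⟨σ_0⟩ = ⟨σ_0⟩² ∑_x ε(x) = 0`
  have hzero : ∑ x : TorusSite ν L, (sgn hL2 x : ℝ) * (sgn hL2 (0 : TorusSite ν L) : ℝ) *
      (expect N m a (X x) * expect (ν := ν) (L := L) N m a (X 0)) = 0 := by
    have h1 : ∀ x : TorusSite ν L, expect N m a (X x) = expect (ν := ν) (L := L) N m a (X 0) :=
      fun x => expect_X_eq_expect_X_zero N m a x
    simp_rw [h1]
    rw [← Finset.sum_mul, ← Finset.sum_mul]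
    have h2 : ∑ x : TorusSite ν L, (sgn hL2 x : ℝ) = 0 := by exact_mod_cast sum_sgn_eq_zero hL2 hν
    rw [h2, zero_mul, zero_mul]
  have hexp' : expect (ν := ν) (L := L) N m a (X 0) =
      -(2 * N * m) * ∑ x : TorusSite ν L, (sgn hL2 x : ℝ) * (sgn hL2 (0 : TorusSite ν L) : ℝ) *
        (expect N m a (X x * X 0) - expect N m a (X x) * expect (ν := ν) (L := L) N m a (X 0)) := by
    have : ∑ x : TorusSite ν L, (sgn hL2 x : ℝ) * (sgn hL2 (0 : TorusSite ν L) : ℝ) *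
        (expect N m a (X x * X 0) - expect N m a (X x) * expect (ν := ν) (L := L) N m a (X 0)) =
        ∑ x : TorusSite ν L, (sgn hL2 x : ℝ) * (sgn hL2 (0 : TorusSite ν L) : ℝ) * expect N m a (X x * X 0) -
        ∑ x : TorusSite ν L, (sgn hL2 x : ℝ) * (sgn hL2 (0 : TorusSite ν L) : ℝ) *
          (expect N m a (X x) * expect (ν := ν) (L := L) N m a (X 0)) := by
      rw [← Finset.sum_sub_distrib]
      exact Finset.sum_congr rfl fun x _ => by ring
    rw [this, hzero, sub_zero]
    exact hexp
  have h2Nm : 0 ≤ 2 * (N : ℝ) * m := by positivity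
  calc expect (ν := ν) (L := L) N m a (X 0)
      = -(2 * N * m) * ∑ x : TorusSite ν L, (sgn hL2 x : ℝ) * (sgn hL2 (0 : TorusSite ν L) : ℝ) *
        (expect N m a (X x * X 0) - expect N m a (X x) * expect (ν := ν) (L := L) N m a (X 0)) := hexp'
    _ ≤ 2 * N * m * |∑ x : TorusSite ν L, (sgn hL2 x : ℝ) * (sgn hL2 (0 : TorusSite ν L) : ℝ) *
        (expect N m a (X x * X 0) - expect N m a (X x) * expect (ν := ν) (L := L) N m a (X 0))| := by
        rw [neg_mul]
        have := neg_abs_le (∑ x : TorusSite ν L, (sgn hL2 x : ℝ) * (sgn hL2 (0 : TorusSite ν L) : ℝ) *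
          (expect N m a (X x * X 0) - expect N m a (X x) * expect (ν := ν) (L := L) N m a (X 0)))
        nlinarith
    _ ≤ 2 * N * m * ∑ x : TorusSite ν L,
        |expect N m a (X x * X 0) - expect N m a (X x) * expect (ν := ν) (L := L) N m a (X 0)| := by
        refine mul_le_mul_of_nonneg_left ((Finset.abs_sum_le_sum_abs _ _).trans
          (Finset.sum_le_sum fun x _ => le_of_eq ?_)) h2Nm
        rw [abs_mul, abs_mul, abs_sgn_cast, abs_sgn_cast, one_mul, one_mul]


/-- `σ̄`-monomials read on the torus: the pair `(x, 0)` gives `σ_{x̄} σ_0`. [folklore] -/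
private theorem monomial_proj_pair_zero {L : ℕ} [NeZero L] (x : Site ν) :
    (monomial (Finsupp.mapDomain (Torus.proj L) (Finsupp.single x 1 + Finsupp.single 0 1)) (1 : ℝ) :
        MvPolynomial (TorusSite ν L) ℝ) = X (Torus.proj L x) * X 0 := by
  have h0 : Torus.proj L (0 : Site ν) = 0 := by funext i; simp [Torus.proj]
  rw [Finsupp.mapDomain_add, Finsupp.mapDomain_single, Finsupp.mapDomain_single, h0, X, X,
    monomial_mul, mul_one]

/-- `σ̄`-monomials read on the torus: a single site. [folklore] -/
private theorem monomial_proj_single {L : ℕ} [NeZero L] (x : Site ν) :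
    (monomial (Finsupp.mapDomain (Torus.proj L) (Finsupp.single x 1)) (1 : ℝ) :
        MvPolynomial (TorusSite ν L) ℝ) = X (Torus.proj L x) := by
  rw [Finsupp.mapDomain_single, X]

/-- NJL expectations of monomials lie in `[0, 1]` at real `m ≥ 0` (Thm. 3.18 (1)). [cite: SalmhoferSeiler1991, Thm. 3.18 (1)] -/
private theorem njl_expect_monomial_mem_Icc' (hν : 1 ≤ ν) {N : ℕ} (hN : 1 ≤ N) {L : ℕ} [NeZero L]
    (hL : Even L) {m : ℝ} (hm : 0 ≤ m) (d : TorusSite ν L →₀ ℕ) :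
    expect N m (njlBondCoeff N) (monomial d 1) ∈ Set.Icc (0 : ℝ) 1 := by
  have hL2' : 2 ≤ L := by
    obtain ⟨k, hk⟩ := hL; have := NeZero.ne L; omega
  exact expect_monomial_mem_Icc hν hL hL2' hN (hasLog_njl N) (njlBondCoeff_zero N) (by simp)
    (fun k hk _ => by rw [Pi.single_eq_of_ne (by omega : k ≠ 1)]) hm d

/-- **Remark 3.12, quantitative finite-volume form: clustering bounds the condensate by the mass.**
For the NJL system (`N ≥ 1`, `ν ≥ 1`) on an even torus `(ℤ/Lℤ)^ν` at real `m > 0`: if the truncated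
two-point function clusters with constants `κ > 0`, `C ≥ 0` in the form of Thm. 3.11 —
`|⟨σ_xσ_y⟩_Λ - ⟨σ_x⟩_Λ⟨σ_y⟩_Λ| ≤ C e^{-κD}` whenever `D ≤ |x_i - y_i|`, `|x_i - y_i| + D ≤ L` — then
`⟨σ_0⟩_Λ(m) ≤ 2Nm (2 + C (∑_{j∈ℤ} e^{-κ|j|/ν})^ν)`: "Inserting the exponential decay with rate
`κ(m)` into [the Ward identity (3.43)]". [cite: SalmhoferSeiler1991, Remark 3.12 and (3.43)] -/
theorem njl_expect_X_le_of_clustering (hν : 1 ≤ ν) {N : ℕ} (hN : 1 ≤ N) {L : ℕ} [NeZero L]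
    (hL : Even L) {m : ℝ} (hm : 0 < m) {κ C : ℝ} (hκ : 0 < κ) (hC : 0 ≤ C)
    (hclust : ∀ (x y : Site ν) (i : Fin ν) (D : ℕ), 1 ≤ D → (D : ℤ) ≤ |x i - y i| →
      |x i - y i| + (D : ℤ) ≤ L →
      |expect N m (njlBondCoeff N) (monomial
            (Finsupp.mapDomain (Torus.proj L) (Finsupp.single x 1 + Finsupp.single y 1)) (1 : ℝ)) -
          expect N m (njlBondCoeff N)
              (monomial (Finsupp.mapDomain (Torus.proj L) (Finsupp.single x 1)) (1 : ℝ)) *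
            expect N m (njlBondCoeff N)
              (monomial (Finsupp.mapDomain (Torus.proj L) (Finsupp.single y 1)) (1 : ℝ))| ≤
        C * Real.exp (-κ * D)) :
    expect N m (njlBondCoeff N) (X (0 : TorusSite ν L)) ≤
      2 * N * m * (2 + C * (∑' j : ℤ, Real.exp (-(κ / ν) * |(j : ℝ)|)) ^ ν) := by
  classical
  set a := njlBondCoeff N with ha
  set T : TorusSite ν L → ℝ := fun x =>
    expect N m a (X x * X 0) - expect N m a (X x) * expect (ν := ν) (L := L) N m a (X 0) with hT
  have h1 := njl_expect_X_le_sum_abs_truncated hν hN hL hm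
  have h2Nm : 0 ≤ 2 * (N : ℝ) * m := by positivity
  -- the term `x = 0`
  have hT0 : |T 0| ≤ 2 := by
    have hXX : (X (0 : TorusSite ν L) * X 0 : MvPolynomial (TorusSite ν L) ℝ) =
        monomial (Finsupp.single 0 1 + Finsupp.single 0 1) 1 := by rw [X, monomial_mul, mul_one]
    have hX : (X (0 : TorusSite ν L) : MvPolynomial (TorusSite ν L) ℝ) = monomial (Finsupp.single 0 1) 1 := rfl
    have e2 := njl_expect_monomial_mem_Icc' hν hN hL hm.le (Finsupp.single (0 : TorusSite ν L) 1 + Finsupp.single 0 1)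
    have e1 := njl_expect_monomial_mem_Icc' hν hN hL hm.le (Finsupp.single (0 : TorusSite ν L) 1)
    rw [← hXX] at e2
    rw [← hX] at e1
    simp only [hT]
    rw [abs_le]
    constructor <;> nlinarith [e1.1, e1.2, e2.1, e2.2]
  -- the terms `x ≠ 0`
  have hTx : ∀ x : TorusSite ν L, x ≠ 0 →
      |T x| ≤ C * ∏ j : Fin ν, Real.exp (-(κ / ν) * |((ZMod.valMinAbs (x j) : ℤ) : ℝ)|) := by
    intro x hx
    obtain ⟨xr, i, D, hproj, hD1, hDle, hDL, hexp⟩ := exists_rep_of_ne_zero hν hκ.le hx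
    have key := hclust xr 0 i D hD1 hDle hDL
    rw [monomial_proj_pair_zero, monomial_proj_single, monomial_proj_single, hproj] at key
    have h0 : Torus.proj L (0 : Site ν) = 0 := by funext i; simp [Torus.proj]
    rw [h0] at key
    exact key.trans (mul_le_mul_of_nonneg_left hexp hC)
  -- sum over the torus
  have hsum : ∑ x : TorusSite ν L, |T x| ≤ 2 + C * (∑' j : ℤ, Real.exp (-(κ / ν) * |(j : ℝ)|)) ^ ν := by
    rw [← Finset.add_sum_erase Finset.univ (fun x => |T x|) (Finset.mem_univ (0 : TorusSite ν L))]
    refine add_le_add hT0 ?_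
    calc ∑ x ∈ Finset.univ.erase (0 : TorusSite ν L), |T x|
        ≤ ∑ x ∈ Finset.univ.erase (0 : TorusSite ν L),
            C * ∏ j : Fin ν, Real.exp (-(κ / ν) * |((ZMod.valMinAbs (x j) : ℤ) : ℝ)|) :=
          Finset.sum_le_sum fun x hx => hTx x (Finset.ne_of_mem_erase hx)
      _ ≤ ∑ x : TorusSite ν L, C * ∏ j : Fin ν, Real.exp (-(κ / ν) * |((ZMod.valMinAbs (x j) : ℤ) : ℝ)|) :=
          Finset.sum_le_sum_of_subset_of_nonneg (Finset.erase_subset _ _) fun x _ _ => by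
            exact mul_nonneg hC (Finset.prod_nonneg fun _ _ => (Real.exp_pos _).le)
      _ ≤ C * (∑' j : ℤ, Real.exp (-(κ / ν) * |(j : ℝ)|)) ^ ν := by
          rw [← Finset.mul_sum]
          exact mul_le_mul_of_nonneg_left (sum_prod_exp_neg_le hκ hν L) hC
  exact h1.trans (mul_le_mul_of_nonneg_left hsum h2Nm)

/-- The even tori `Λ_{2(j+1)}` exhaust `ℤ^ν`. [folklore] -/
private theorem tendsto_two_mul_succ' : Tendsto (fun j : ℕ => 2 * (j + 1)) atTop atTop :=
  tendsto_atTop_atTop.2 fun b => ⟨b, fun j hj => by omega⟩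

/-- **Remark 3.12 in the thermodynamic limit**: if the clustering constants are uniform on a mass
interval `(0, m₀]` (all even tori), the condensate `s(m) = lim_Λ ⟨σ_0⟩_Λ(m)` is `O(m)` there:
`s(m) ≤ 2Nm(2 + C G_ν(κ)^ν)` for `0 < m ≤ m₀`. [cite: SalmhoferSeiler1991, Remark 3.12 and (3.43)] -/
theorem njl_condensate_le_of_uniformClustering (hν : 1 ≤ ν) {N : ℕ} (hN : 1 ≤ N) {κ C m₀ : ℝ}
    (hκ : 0 < κ) (hC : 0 ≤ C)
    (hclust : ∀ m : ℝ, 0 < m → m ≤ m₀ → ∀ (L : ℕ) [NeZero L], Even L →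
      ∀ (x y : Site ν) (i : Fin ν) (D : ℕ), 1 ≤ D → (D : ℤ) ≤ |x i - y i| →
      |x i - y i| + (D : ℤ) ≤ L →
      |expect N m (njlBondCoeff N) (monomial
            (Finsupp.mapDomain (Torus.proj L) (Finsupp.single x 1 + Finsupp.single y 1)) (1 : ℝ)) -
          expect N m (njlBondCoeff N)
              (monomial (Finsupp.mapDomain (Torus.proj L) (Finsupp.single x 1)) (1 : ℝ)) *
            expect N m (njlBondCoeff N)
              (monomial (Finsupp.mapDomain (Torus.proj L) (Finsupp.single y 1)) (1 : ℝ))| ≤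
        C * Real.exp (-κ * D))
    {s : ℝ → ℝ} (hs : ∀ (Ls : ℕ → ℕ) [∀ j, NeZero (Ls j)], Tendsto Ls atTop atTop →
      ∀ m : ℝ, m ≠ 0 →
        Tendsto (fun j => expect (ν := ν) (L := Ls j) N m (njlBondCoeff N) (X 0)) atTop (𝓝 (s m)))
    {m : ℝ} (hm : 0 < m) (hmm₀ : m ≤ m₀) :
    s m ≤ 2 * N * m * (2 + C * (∑' j : ℤ, Real.exp (-(κ / ν) * |(j : ℝ)|)) ^ ν) := by
  have ht := hs (fun j => 2 * (j + 1)) tendsto_two_mul_succ' m hm.ne'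
  refine le_of_tendsto ht (Eventually.of_forall fun j => ?_)
  haveI : NeZero (2 * (j + 1)) := ⟨by omega⟩
  exact njl_expect_X_le_of_clustering hν hN (L := 2 * (j + 1)) ⟨j + 1, by ring⟩ hm hκ hC
    (hclust m hm hmm₀ (2 * (j + 1)) ⟨j + 1, by ring⟩)

/-- **Remark 3.12 (weak Goldstone theorem): when chiral symmetry is broken, the clustering of
Thm. 3.11 cannot be uniform as the mass vanishes.**  For the NJL system with `N ≥ 1`, `ν ≥ 3` and
`2S(ν)/N < 1` (so that `X > 0`, Cor. 4.4 (1)): for every rate `κ > 0`, prefactor `C ≥ 0` and mass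
`m₀ > 0` there are a mass `0 < m ≤ m₀`, an even torus and separated lattice points at which
`|⟨σ_xσ_y⟩_Λ - ⟨σ_x⟩_Λ⟨σ_y⟩_Λ|(m) > C e^{-κD}` — i.e. along `m → 0+` the optimal constants satisfy
`κ(m) → 0` or `C(m) → ∞` ("if chiral symmetry is broken in the sense of `X ≠ 0`, the mass gap
`κ(m)` must go to zero as the mass vanishes"; with the Erratum's (5), `C = 1` for real `m`, this is
`κ(m) → 0` — that sharper form is not formalised here). [cite: SalmhoferSeiler1991, Remark 3.12 and Cor. 4.4 (1)][cite: SalmhoferSeiler1992Erratum, (5)] -/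
theorem njl_clustering_not_uniform_as_mass_vanishes (hν : 3 ≤ ν) {N : ℕ} (hN : 1 ≤ N)
    (hS : 2 * fluctS ν / N < 1) {κ C m₀ : ℝ} (hκ : 0 < κ) (hC : 0 ≤ C) (hm₀ : 0 < m₀) :
    ¬ (∀ m : ℝ, 0 < m → m ≤ m₀ → ∀ (L : ℕ) [NeZero L], Even L →
      ∀ (x y : Site ν) (i : Fin ν) (D : ℕ), 1 ≤ D → (D : ℤ) ≤ |x i - y i| →
      |x i - y i| + (D : ℤ) ≤ L →
      |expect N m (njlBondCoeff N) (monomial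
            (Finsupp.mapDomain (Torus.proj L) (Finsupp.single x 1 + Finsupp.single y 1)) (1 : ℝ)) -
          expect N m (njlBondCoeff N)
              (monomial (Finsupp.mapDomain (Torus.proj L) (Finsupp.single x 1)) (1 : ℝ)) *
            expect N m (njlBondCoeff N)
              (monomial (Finsupp.mapDomain (Torus.proj L) (Finsupp.single y 1)) (1 : ℝ))| ≤
        C * Real.exp (-κ * D)) := by
  intro hclust
  have hν1 : 1 ≤ ν := by omega
  obtain ⟨s, hs⟩ := njl_exists_condensate (ν := ν) hN hν1
  -- Cor. 4.4 (1): `liminf_{m → 0+} s(m) > 0`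
  have hs' : ∀ m : ℝ, 0 < m → ∃ (Ls : ℕ → ℕ) (_ : ∀ j, NeZero (Ls j)),
      (∀ j, Even (Ls j)) ∧ Tendsto Ls atTop atTop ∧
        Tendsto (fun j => expect (ν := ν) (L := Ls j) N m (njlBondCoeff N) (X 0)) atTop (𝓝 (s m)) :=
    fun m hm => ⟨fun j => 2 * (j + 1), fun j => ⟨by show 2 * (j + 1) ≠ 0; omega⟩,
      fun j => ⟨j + 1, by ring⟩,
      tendsto_two_mul_succ', hs _ tendsto_two_mul_succ' m hm.ne'⟩
  obtain ⟨-, -, hpos⟩ := njl_chiralOrderParameter_bounds hν hN hS hs'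
  set ℓ := liminf s (𝓝[>] (0 : ℝ)) with hℓ
  set K : ℝ := 2 * N * (2 + C * (∑' j : ℤ, Real.exp (-(κ / ν) * |(j : ℝ)|)) ^ ν) with hK
  have hK0 : 0 ≤ K := by positivity
  -- `s` is bounded below by `0` on `(0, ∞)`
  have hs0 : ∀ᶠ m in 𝓝[>] (0 : ℝ), 0 ≤ s m := by
    filter_upwards [self_mem_nhdsWithin] with m hm
    have ht := hs (fun j => 2 * (j + 1)) tendsto_two_mul_succ' m (ne_of_gt hm)
    refine ge_of_tendsto ht (Eventually.of_forall fun j => ?_)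
    haveI : NeZero (2 * (j + 1)) := ⟨by omega⟩
    exact njl_expect_X_nonneg hν1 (L := 2 * (j + 1)) ⟨j + 1, by ring⟩ hN (le_of_lt hm) 0
  have hev1 : ∀ᶠ m in 𝓝[>] (0 : ℝ), ℓ / 2 < s m :=
    eventually_lt_of_lt_liminf (by rw [hℓ]; linarith) (isBoundedUnder_of_eventually_ge hs0)
  -- the `O(m)` bound on `(0, m₀]`
  have hev2 : ∀ᶠ m in 𝓝[>] (0 : ℝ), s m ≤ K * m := by
    have hm₀mem : Set.Ioo (0 : ℝ) m₀ ∈ 𝓝[>] (0 : ℝ) := Ioo_mem_nhdsGT hm₀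
    filter_upwards [hm₀mem] with m hm
    have := njl_condensate_le_of_uniformClustering hν1 hN hκ hC hclust hs hm.1 hm.2.le
    rw [hK]
    calc s m ≤ 2 * N * m * (2 + C * (∑' j : ℤ, Real.exp (-(κ / ν) * |(j : ℝ)|)) ^ ν) := this
      _ = 2 * N * (2 + C * (∑' j : ℤ, Real.exp (-(κ / ν) * |(j : ℝ)|)) ^ ν) * m := by ring
  -- `K m < ℓ/2` near `0`
  have hev3 : ∀ᶠ m in 𝓝[>] (0 : ℝ), K * m < ℓ / 2 := by
    have ht : Tendsto (fun m : ℝ => K * m) (𝓝[>] (0 : ℝ)) (𝓝 (K * 0)) :=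
      ((continuous_const.mul continuous_id).tendsto 0).mono_left nhdsWithin_le_nhds
    rw [mul_zero] at ht
    exact ht.eventually (gt_mem_nhds (by linarith))
  obtain ⟨m, h1, h2, h3⟩ := (hev1.and (hev2.and hev3)).exists
  linarith

/-- **Weak Goldstone theorem for strongly coupled lattice QED (`N = 1`, `ν ≥ 4`) and the NJL
models (`N ≥ 2`, `ν ≥ 3`)**, hypothesis-free: chiral symmetry is broken there (the tree's
`qed_chiralSymmetryBreaking` / `njl_chiralSymmetryBreaking`, Cor. 4.4 (1) with the certified
`S(ν)`), so the clustering constants of Thm. 3.11 cannot stay uniform on any `(0, m₀]`. [cite: SalmhoferSeiler1991, Remark 3.12 and Cor. 4.4 (1)] -/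
theorem njl_clustering_not_uniform_as_mass_vanishes' (hν : 3 ≤ ν) {N : ℕ} (hN : 1 ≤ N)
    (h : 4 ≤ ν ∨ 2 ≤ N) {κ C m₀ : ℝ} (hκ : 0 < κ) (hC : 0 ≤ C) (hm₀ : 0 < m₀) :
    ¬ (∀ m : ℝ, 0 < m → m ≤ m₀ → ∀ (L : ℕ) [NeZero L], Even L →
      ∀ (x y : Site ν) (i : Fin ν) (D : ℕ), 1 ≤ D → (D : ℤ) ≤ |x i - y i| →
      |x i - y i| + (D : ℤ) ≤ L →
      |expect N m (njlBondCoeff N) (monomial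
            (Finsupp.mapDomain (Torus.proj L) (Finsupp.single x 1 + Finsupp.single y 1)) (1 : ℝ)) -
          expect N m (njlBondCoeff N)
              (monomial (Finsupp.mapDomain (Torus.proj L) (Finsupp.single x 1)) (1 : ℝ)) *
            expect N m (njlBondCoeff N)
              (monomial (Finsupp.mapDomain (Torus.proj L) (Finsupp.single y 1)) (1 : ℝ))| ≤
        C * Real.exp (-κ * D)) :=
  njl_clustering_not_uniform_as_mass_vanishes hν hN (two_mul_fluctS_div_lt_one hν hN h) hκ hC hm₀


/-- **At each fixed mass the clustering constants exist** (Thm. 3.11 in the real vocabulary, from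
`NJLExponentialClustering`): for real `m ≠ 0` there are `κ(m) > 0`, `C(m) ≥ 0` with
`|⟨σ_xσ_y⟩_Λ - ⟨σ_x⟩_Λ⟨σ_y⟩_Λ|(m) ≤ C(m) e^{-κ(m)D}` in every volume — the hypothesis of
`njl_clustering_not_uniform_as_mass_vanishes` holds mass by mass; what fails is uniformity in
`m → 0+`. [cite: SalmhoferSeiler1991, Thm. 3.11 and Remark 3.12][cite: SalmhoferSeiler1992Erratum, (1)] -/
theorem njl_clustering_constants_at_fixed_mass (hν : 1 ≤ ν) {N : ℕ} (hN : 1 ≤ N) {m : ℝ}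
    (hm : m ≠ 0) :
    ∃ κ : ℝ, 0 < κ ∧ ∃ C : ℝ, 0 ≤ C ∧ ∀ (L : ℕ) [NeZero L] (x y : Site ν) (i : Fin ν) (D : ℕ),
      1 ≤ D → (D : ℤ) ≤ |x i - y i| → |x i - y i| + (D : ℤ) ≤ L →
      |expect N m (njlBondCoeff N) (monomial
            (Finsupp.mapDomain (Torus.proj L) (Finsupp.single x 1 + Finsupp.single y 1)) (1 : ℝ)) -
          expect N m (njlBondCoeff N)
              (monomial (Finsupp.mapDomain (Torus.proj L) (Finsupp.single x 1)) (1 : ℝ)) *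
            expect N m (njlBondCoeff N)
              (monomial (Finsupp.mapDomain (Torus.proj L) (Finsupp.single y 1)) (1 : ℝ))| ≤
        C * Real.exp (-κ * D) := by
  have hmr : ((m : ℂ)).re ≠ 0 := by rwa [Complex.ofReal_re]
  obtain ⟨κ, hκ, C, hC0, h⟩ :=
    njl_twoPoint_exponentialClustering (ν := ν) hN hν (m := (m : ℂ)) (Or.inl hmr)
  refine ⟨κ, hκ, C, hC0, fun L _ x y i D hD1 hD hL => ?_⟩
  have key := h L x y i D hD1 hD hL
  rw [njlCorrelation_ofReal, njlCorrelation_ofReal, njlCorrelation_ofReal, ← Complex.ofReal_mul,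
    ← Complex.ofReal_sub, Complex.norm_real, Real.norm_eq_abs] at key
  exact key

end ComplexSpin

end Literature.MathematicalPhysics.StatisticalMechanics
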